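import Summits.QuantumFields.YangMills.Theorems.FluctuationComparisonRegPrIntLLoopLedgerGasOfAtomGas
import Summits.QuantumFields.YangMills.Theorems.FluctuationComparisonRegPrIntLS2BetaKPLCriterion
import HarnessLib

/-!
# THE ATOM-GAS DOOR, PINNED EDITION: a per-ATOM pinned criterion `Σ_{X ∋ c} K̄(X)·e^{τ|X| + κℓ(X)} ≤ τ` (the shape TREESUM∕GBND deliver) gives the
# `KPGasOn` text on bond polymers through a cell map (size `a := τ·|atoms|`, one-bond size `τ`)

Cell `ym3-torus` (YM ladder rung R3 = continuum `SU(2)` Yang–Mills on the three-torus — a RUNG, NOT d = 4, NOT infinite volume, NOT a mass gap, NOT Clay).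
Width seat `ym3-torus-px20` (gen 15); `--supports stmt-QuantumFields-20520 --as helper`, count-neutral, definition-free, default heartbeats; registry v11.4 №36
untouched.  Sequel of ✓`…LoopLedgerGasOfAtomGas.kpGasOn_of_atomKPGas` (p787610), which takes an atom-level SIZE FUNCTION `a` with the Kotecký–Preiss inequality; what a
tree-graph bound natively gives (AnchorGap ✓TREESUM `stub_treeWeightPolymerSum` + ✓GBND `stub_bbfActivityTreeBound`, px19 g17; [Brydges1986] §3, [Rivasseau1991] (III.1.19))
is a PER-ATOM PINNED SUM.  With ✓KPL-E `exists_size_of_pinned_criterion` (generic, here at the ATOM type) the size `a X := τ·|X|` is manufactured: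
* §1 `pinned_extend_by_zero` (extending an `𝒜`-majorant by zero off `𝒜` keeps the pinned sums and makes `univ`-sums `𝒜`-sums).
* §2 ★★ `kpGasOn_of_atomPinned` — cell map `blk` hitting every atom; atom activities `K` on the family `𝒜` (size ≥ 1 members: `∅ ∉ 𝒜`), cell-local, pushed to bond activities `w`;
  majorant `K̄ ≥ 0` on `𝒜` dominating `|K_U|` over the window; lengths `ℓ ≥ 0` with the CELL-DIAMETER clause; `τ ≥ 0`; the PER-ATOM PINNED CRITERION
  `∀ c, Σ_{X ∈ 𝒜, c ∈ X} K̄ X · e^{τ|X| + κ ℓ X} ≤ τ` ⟹ the `KPGasOn` TEXT VERBATIM for `w` on `W` at rate `κ` with one-bond size `τ`.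

HONEST SCOPE.  Finite combinatorics over landed lemmas; the atom data are HYPOTHESES; nothing of Bałaban's or GREP's is asserted or proved; GAS, GAS₁, LFG, REP and
`FluctuationComparisonRegPrIntL` (stmt-QuantumFields-20520) are NOT proved; no summit statement is proved by a helper; rung R3 = SU(2) YM₃ on T³ — NOT d = 4, NOT infinite
volume, NOT a mass gap, NOT Clay; the Yang–Mills mass gap is NOT proved.

References: D. C. Brydges, Les Houches 1984 [Brydges1986] (§3); V. Rivasseau, *From Perturbative to Constructive Renormalization* (1991) [Rivasseau1991] (§III.1 (III.1.19));
R. Kotecký, D. Preiss, CMP **103** (1986) 491–498 [KoteckyPreiss1986] ((1) p.492); T. Bałaban, CMP **122** (1989) 355–392 [Balaban1989LargeFieldII] ((1.97)–(1.100)).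
-/

set_option autoImplicit false

noncomputable section

open Finset
open Literature.Probability.LatticeModels
open Literature.MathematicalPhysics.QuantumFieldTheory.Balaban1983to89
open Summit.QuantumFields.YangMills.Theorems.FluctuationComparisonRegPrIntLS2BetaKPLCriterion

namespace Summit.QuantumFields.YangMills.Theorems.LoopLedgerGasOfAtomGas

/-! ## §1 Extending an `𝒜`-majorant by zero -/

section Extend

variable {β : Type*} [Fintype β] [DecidableEq β]

/-- Sums of the zero-extension of an `𝒜`-function over a filtered `univ` are the `𝒜`-filtered sums. [folklore] -/
theorem sum_filter_extend_by_zero (𝒜 : Finset (Finset β)) (f : Finset β → ℝ) (p : Finset β → Prop) [DecidablePred p] :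
    ∑ X ∈ Finset.univ.filter p, (if X ∈ 𝒜 then f X else 0) = ∑ X ∈ 𝒜.filter p, f X := by
  rw [← Finset.sum_filter, Finset.filter_filter]
  refine Finset.sum_congr ?_ fun _ _ => rfl
  ext X; simp [and_comm]

end Extend

/-! ## §2 The pinned edition of the atom-gas door -/

section Pinned

variable {P : Params} {β : Type*} [Fintype β] [DecidableEq β] {G : Type*} (blk : PBond P 0 → β)

open Classical in
/-- ★★ **PER-ATOM PINNED CRITERION ⟹ THE `KPGasOn` TEXT ON BOND POLYMERS.**  As ✓`kpGasOn_of_atomKPGas`, but the atom-level Kotecký–Preiss data are delivered in PINNED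
form: `K̄ ≥ 0` on the family `𝒜` (`∅ ∉ 𝒜`), `τ ≥ 0`, and for every atom `c`, `Σ_{X ∈ 𝒜, c ∈ X} K̄ X · e^{τ·|X| + κ·ℓ X} ≤ τ`; conclusion: the `KPGasOn` text VERBATIM for the
pushed bond activities `w` on `W` at rate `κ` with one-bond size `τ` (size `a X := τ·|X.image blk|… ` manufactured by ✓`exists_size_of_pinned_criterion` at the atom type).
[cite: Rivasseau1991, §III.1 (III.1.19); KoteckyPreiss1986, (1) p.492; Balaban1989LargeFieldII, (1.97)-(1.100) pp.389-390] -/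
theorem kpGasOn_of_atomPinned (hsurj : Function.Surjective blk) (𝒜 : Finset (Finset β)) (h𝒜 : ∅ ∉ 𝒜) (W : Set (GaugeField P 0 G)) (κ τ : ℝ) (hτ : 0 ≤ τ)
    (K : GaugeField P 0 G → Finset β → ℝ) (w : GaugeField P 0 G → Finset (PBond P 0) → ℝ)
    (hKloc : ∀ (X : Finset β) (U U' : GaugeField P 0 G), (∀ b : PBond P 0, blk b ∈ X → U b = U' b) → K U X = K U' X)
    (hwon : ∀ U, ∀ X ∈ 𝒜, w U (Finset.univ.filter (fun b => blk b ∈ X)) = K U X)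
    (hwoff : ∀ U (Y : Finset (PBond P 0)), (∀ X ∈ 𝒜, Finset.univ.filter (fun b => blk b ∈ X) ≠ Y) → w U Y = 0)
    (Kbar ℓ : Finset β → ℝ) (hKbar : ∀ X ∈ 𝒜, 0 ≤ Kbar X)
    (hdom : ∀ U, U ∈ W → ∀ X ∈ 𝒜, |K U X| ≤ Kbar X)
    (hℓ : ∀ X, 0 ≤ ℓ X)
    (hdiam : ∀ (X : Finset β) (b b' : PBond P 0), blk b ∈ X → blk b' ∈ X → (b.src.tdist b'.src : ℝ) ≤ ℓ X)
    (hcrit : ∀ c : β, ∑ X ∈ 𝒜.filter (fun X => c ∈ X), Kbar X * Real.exp (τ * (X.card : ℝ) + κ * ℓ X) ≤ τ) :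
    ∃ (wbar a ℓ : Finset (PBond P 0) → ℝ),
      (∀ U, w U ∅ = 0) ∧
      (∀ (X : Finset (PBond P 0)) (U U' : GaugeField P 0 G), (∀ e ∈ X, U e = U' e) → w U X = w U' X) ∧
      (∀ X, 0 ≤ a X) ∧ (∀ X, 0 ≤ ℓ X) ∧
      (∀ U, U ∈ W → ∀ X, |w U X| ≤ wbar X) ∧
      (∀ X : Finset (PBond P 0), ∀ e ∈ X, ∀ e' ∈ X, (e.src.tdist e'.src : ℝ) ≤ ℓ X) ∧
      (∀ X : Finset (PBond P 0), ∑ X' ∈ Finset.univ.filter (fun X' => polyInc X' X),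
          wbar X' * Real.exp (a X' + κ * ℓ X') ≤ a X) ∧
      (∀ e : PBond P 0, a {e} ≤ τ) := by
  -- the zero-extended majorant and the atom-level size function from the pinned criterion
  set Kb : Finset β → ℝ := fun X => if X ∈ 𝒜 then Kbar X else 0 with hKb
  have hKb0 : ∀ X, 0 ≤ Kb X := fun X => by
    simp only [hKb]; split_ifs with h
    · exact hKbar X h
    · exact le_rfl
  have hKbe : Kb ∅ = 0 := by simp only [hKb, if_neg h𝒜]
  have hcrit' : ∀ c : β, ∑ X' ∈ Finset.univ.filter (fun X' : Finset β => c ∈ X'),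
      Kb X' * Real.exp (τ * (X'.card : ℝ) + κ * ℓ X') ≤ τ := by
    intro c
    have h := sum_filter_extend_by_zero 𝒜 (fun X => Kbar X * Real.exp (τ * (X.card : ℝ) + κ * ℓ X)) (fun X => c ∈ X)
    refine le_trans (le_of_eq ?_) (hcrit c)
    rw [← h]
    refine Finset.sum_congr rfl fun X _ => ?_
    simp only [hKb]; split_ifs <;> simp
  obtain ⟨a, ha, hKP, hpin⟩ := exists_size_of_pinned_criterion Kb ℓ κ hτ hKb0 hKbe hcrit'
  refine kpGasOn_of_atomKPGas blk hsurj 𝒜 W κ τ K w (fun U h => absurd h h𝒜) hKloc hwon hwoff Kb a ℓ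
    (fun U hU X hX => by simp only [hKb, if_pos hX]; exact hdom U hU X hX) ha hℓ hdiam (fun X => ?_) (fun e => hpin (blk e))
  -- the `𝒜`-filtered KP sum is the `univ`-filtered one of the zero extension
  have h := sum_filter_extend_by_zero 𝒜 (fun X' => Kb X' * Real.exp (a X' + κ * ℓ X')) (fun X' => polyInc X' X)
  refine le_trans (le_of_eq ?_) (hKP X)
  rw [← h]
  refine Finset.sum_congr rfl fun X' _ => ?_
  simp only [hKb]; split_ifs <;> simp

end Pinned

end Summit.QuantumFields.YangMills.Theorems.LoopLedgerGasOfAtomGas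

end
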